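import Mathlib
import HarnessLib

/-!
# The intermediary scales `ℓ_k < n ≤ m ≤ M ≤ N < ℓ_{k+1}` of the proof of Lemma 4.4 / 6.2 (Aizenman–Duminil-Copin 2021)

Topic `Literature/Probability/LatticeModels`. The proof of the intersection property of
M. Aizenman, H. Duminil-Copin, Ann. of Math. **194** (2021), arXiv:1912.07973
[AizenmanDuminilCopinAnnals2021] (Lemma 4.4, p. 11: "introduce the intermediate distance
`ℓ_k ≤ n := √(ℓ_kℓ_{k+1}) ≤ ℓ_{k+1}`" — rather (4.5): "intermediary integers `n ≤ m ≤ M ≤ N`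
satisfying `ℓ_k^4 ≥ n ≥ ℓ_k^{3+}`, `n^4 ≥ m ≥ n^{3+}`, `M^4 ≥ N ≥ M^{3+}`, `N^4 ≥ ℓ_{k+1} ≥ N^{3+}`";
Lemma 6.2, p. 21, (6.3): the same) needs, between two scales `a = ℓ_k` and `b = ℓ_{k+1}` with
`b ≥ a^{α}` (`α > 3⁴`, Remark 4.5: "we need the exponent connecting the inner and outer radii of
annuli to be strictly larger than 3"), four integers with: each of the ratios `a³/n`, `n³/m`,
`M³/N`, `N³/b` small (these control the four bad events `F₁,…,F₄`), and `M` polynomially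
comparable to `b`, `m` polynomially comparable to `a` (these control, through Lemma 6.3, the bubble
diagrams `B_M ≥ B_b/(1+15C)`, `B_{m-1} ≤ (1+15C)B_a`).

This file provides such integers with explicit guarantees, for a margin parameter `T ≥ 1`
(the largeness of the four ratios, `1/T`): `n = T a³`, `m = T⁴ a⁹`, `N` the largest integer with
`T N³ ≤ b` and `M` the largest with `T M³ ≤ N` (`Nat.findGreatest`), under the single hypothesis
`T^40 a^81 ≤ b` (which `b ≥ a^{81 + 40T}`, `a ≥ 2` implies): `exists_intermediaryScales`.
Pure arithmetic; no named fact is introduced.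

## References

* M. Aizenman, H. Duminil-Copin, Ann. of Math. 194 (2021), arXiv:1912.07973, §4.2, Lemma 4.4 and
  display (4.5), Remark 4.5 (pp. 11–12); §6.1, proof of Lemma 6.2, display (6.3) (p. 21)
  [AizenmanDuminilCopinAnnals2021].

## Mathlib

`Nat.findGreatest`, `Nat.findGreatest_spec`, `Nat.le_findGreatest`, `Nat.findGreatest_le`,
`Nat.findGreatest_is_greatest`.
-/

namespace Literature.Probability.LatticeModels

/-- The largest `n ≤ b` with `T n³ ≤ b`: it satisfies `T n³ ≤ b`, dominates every `k` with
`T k³ ≤ b`, and `b < T (n+1)³` (`T ≥ 1`). [folklore] -/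
theorem cubeRootFloor_spec {T b : ℕ} (hT : 1 ≤ T) :
    T * Nat.findGreatest (fun n => T * n ^ 3 ≤ b) b ^ 3 ≤ b ∧
      (∀ k, T * k ^ 3 ≤ b → k ≤ Nat.findGreatest (fun n => T * n ^ 3 ≤ b) b) ∧
      b < T * (Nat.findGreatest (fun n => T * n ^ 3 ≤ b) b + 1) ^ 3 := by
  set N := Nat.findGreatest (fun n => T * n ^ 3 ≤ b) b with hN
  have hle_b : ∀ k, T * k ^ 3 ≤ b → k ≤ b := by
    intro k hk
    calc k ≤ k ^ 3 := Nat.le_self_pow (by norm_num) k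
      _ ≤ T * k ^ 3 := Nat.le_mul_of_pos_left _ (by omega)
      _ ≤ b := hk
  refine ⟨?_, ?_, ?_⟩
  · have h := Nat.findGreatest_spec (P := fun n => T * n ^ 3 ≤ b) (m := 0) (n := b) (Nat.zero_le b) (by simp)
    exact h
  · intro k hk
    exact Nat.le_findGreatest (hle_b k hk) hk
  · by_contra hcon
    push Not at hcon
    have h1 : N + 1 ≤ b := hle_b (N + 1) hcon
    have h2 := Nat.findGreatest_is_greatest (P := fun n => T * n ^ 3 ≤ b) (Nat.lt_succ_self N) h1
    exact h2 hcon

/-- **The intermediary scales** between `a` and `b` with margin `T`: given `T ≥ 1`, `a ≥ 2` and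
`T^40 a^81 ≤ b`, the integers `n = T a³`, `m = T⁴ a⁹`, `N = max{k : T k³ ≤ b}`, `M = max{k : T k³ ≤ N}`
satisfy `a < n ≤ m ≤ M ≤ N < b`, the separations `2a ≤ n`, `2n ≤ m`, `2M ≤ N`, `2N ≤ b`, the
margins `T M³ ≤ N`, `T N³ ≤ b` (together with `n = T a³`, `m = T n³`: the four ratios `a³/n`,
`n³/m`, `M³/N`, `N³/b` are `≤ 1/T`), and the comparabilities `b ≤ M^{11}`, `512 T⁴ ≤ M` (the scale
`M` is polynomially comparable to `b`). [cite: AizenmanDuminilCopinAnnals2021, arXiv:1912.07973 §4.2, display (4.5) and Remark 4.5 (pp. 11–12); §6.1, display (6.3) (p. 21)] -/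
theorem exists_intermediaryScales {T a b : ℕ} (hT : 1 ≤ T) (ha : 2 ≤ a) (hb : T ^ 40 * a ^ 81 ≤ b) :
    ∃ n₀ m₀ M₀ N₀ : ℕ, n₀ = T * a ^ 3 ∧ m₀ = T ^ 4 * a ^ 9 ∧
      a < n₀ ∧ n₀ ≤ m₀ ∧ m₀ ≤ M₀ ∧ M₀ ≤ N₀ ∧ N₀ < b ∧
      2 * a ≤ n₀ ∧ 2 * n₀ ≤ m₀ ∧ 2 * M₀ ≤ N₀ ∧ 2 * N₀ ≤ b ∧
      T * M₀ ^ 3 ≤ N₀ ∧ T * N₀ ^ 3 ≤ b ∧ b ≤ M₀ ^ 11 ∧ 512 * T ^ 4 ≤ M₀ := by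
  set n₀ := T * a ^ 3 with hn₀
  set m₀ := T ^ 4 * a ^ 9 with hm₀
  obtain ⟨hN, hNmax, hNlt⟩ := cubeRootFloor_spec (b := b) hT
  set N₀ := Nat.findGreatest (fun n => T * n ^ 3 ≤ b) b with hN₀
  obtain ⟨hM, hMmax, hMlt⟩ := cubeRootFloor_spec (b := N₀) hT
  set M₀ := Nat.findGreatest (fun n => T * n ^ 3 ≤ N₀) N₀ with hM₀
  -- basic sizes
  have ha1 : 1 ≤ a := by omega
  have ha3 : 8 ≤ a ^ 3 :=
    calc 8 = 2 ^ 3 := by norm_num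
      _ ≤ a ^ 3 := Nat.pow_le_pow_left ha 3
  have ha9 : 512 ≤ a ^ 9 :=
    calc 512 = 2 ^ 9 := by norm_num
      _ ≤ a ^ 9 := Nat.pow_le_pow_left ha 9
  have h4a : 4 * a ≤ a ^ 3 :=
    calc 4 * a = 2 * 2 * a := by ring
      _ ≤ a * a * a := Nat.mul_le_mul (Nat.mul_le_mul ha ha) le_rfl
      _ = a ^ 3 := by ring
  have hTa : a ^ 3 ≤ T * a ^ 3 := Nat.le_mul_of_pos_left _ (by omega)
  have hT4 : 1 ≤ T ^ 4 := Nat.one_le_pow _ _ hT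
  -- `m₀ ≤ M₀`: by maximality, from `T (T m₀³)³ ≤ b`
  have hkey : T * (T * m₀ ^ 3) ^ 3 = T ^ 40 * a ^ 81 := by rw [hm₀]; ring
  have hTm : T * m₀ ^ 3 ≤ N₀ := by
    refine hNmax _ ?_
    rw [hkey]; exact hb
  have hmM : m₀ ≤ M₀ := hMmax _ hTm
  have hm512 : 512 * T ^ 4 ≤ m₀ := by
    rw [hm₀]
    calc 512 * T ^ 4 = T ^ 4 * 512 := by ring
      _ ≤ T ^ 4 * a ^ 9 := Nat.mul_le_mul_left _ ha9
  have hM512 : 512 * T ^ 4 ≤ M₀ := hm512.trans hmM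
  have hM2 : 2 ≤ M₀ := le_trans (by omega) hM512
  have hM1 : 1 ≤ M₀ := by omega
  -- the chain
  have hMN : M₀ ≤ N₀ := le_trans (le_trans (Nat.le_self_pow (by norm_num) M₀)
    (Nat.le_mul_of_pos_left _ (by omega))) hM
  have hN1 : 1 ≤ N₀ := hM1.trans hMN
  have h2M : 2 * M₀ ≤ N₀ := by
    calc 2 * M₀ ≤ M₀ * M₀ := Nat.mul_le_mul_right M₀ hM2
      _ ≤ M₀ * M₀ * M₀ := Nat.le_mul_of_pos_right _ (by omega)
      _ = M₀ ^ 3 := by ring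
      _ ≤ T * M₀ ^ 3 := Nat.le_mul_of_pos_left _ (by omega)
      _ ≤ N₀ := hM
  have hN2 : 2 ≤ N₀ := le_trans (by omega) (le_trans (by omega : 2 ≤ 2 * M₀) h2M)
  have h2N : 2 * N₀ ≤ b := by
    calc 2 * N₀ ≤ N₀ * N₀ := Nat.mul_le_mul_right N₀ hN2
      _ ≤ N₀ * N₀ * N₀ := Nat.le_mul_of_pos_right _ (by omega)
      _ = N₀ ^ 3 := by ring
      _ ≤ T * N₀ ^ 3 := Nat.le_mul_of_pos_left _ (by omega)
      _ ≤ b := hN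
  have hNb : N₀ < b := by omega
  -- `b ≤ M₀^11`: `b < T (N₀+1)³`, `N₀ < T (M₀+1)³`
  have hbM : b ≤ M₀ ^ 11 := by
    have h1 : N₀ + 1 ≤ T * (M₀ + 1) ^ 3 := hMlt
    have h2 : b < T * (N₀ + 1) ^ 3 := hNlt
    have h3 : b < T * (T * (M₀ + 1) ^ 3) ^ 3 := lt_of_lt_of_le h2 (by gcongr)
    have h4 : T * (T * (M₀ + 1) ^ 3) ^ 3 = T ^ 4 * (M₀ + 1) ^ 9 := by ring
    have h5 : (M₀ + 1) ^ 9 ≤ (2 * M₀) ^ 9 := Nat.pow_le_pow_left (by omega) 9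
    have h6 : T ^ 4 * (M₀ + 1) ^ 9 ≤ T ^ 4 * (512 * M₀ ^ 9) := by
      have : (2 * M₀) ^ 9 = 512 * M₀ ^ 9 := by ring
      rw [← this]; exact Nat.mul_le_mul_left _ h5
    have h7 : T ^ 4 * (512 * M₀ ^ 9) = (512 * T ^ 4) * M₀ ^ 9 := by ring
    have h8 : (512 * T ^ 4) * M₀ ^ 9 ≤ M₀ * M₀ ^ 9 := Nat.mul_le_mul_right _ hM512
    have h9 : M₀ * M₀ ^ 9 ≤ M₀ ^ 11 := by
      calc M₀ * M₀ ^ 9 = M₀ ^ 10 := by ring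
        _ ≤ M₀ ^ 11 := Nat.pow_le_pow_right hM1 (by norm_num)
    omega
  have hT3 : 0 < T ^ 3 := Nat.pow_pos (by omega)
  have ha6 : 2 ≤ a ^ 6 :=
    calc 2 ≤ 2 ^ 6 := by norm_num
      _ ≤ a ^ 6 := Nat.pow_le_pow_left ha 6
  have hsplit : T ^ 4 * a ^ 9 = T * a ^ 3 * (T ^ 3 * a ^ 6) := by ring
  refine ⟨n₀, m₀, M₀, N₀, rfl, rfl, ?_, ?_, hmM, hMN, hNb, ?_, ?_, h2M, h2N, hM, hN, hbM, hM512⟩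
  · rw [hn₀]; omega
  · rw [hn₀, hm₀, hsplit]
    exact Nat.le_mul_of_pos_right _ (Nat.mul_pos hT3 (Nat.pow_pos (by omega)))
  · rw [hn₀]; omega
  · rw [hn₀, hm₀, hsplit]
    have h6 : 2 ≤ T ^ 3 * a ^ 6 := le_trans ha6 (Nat.le_mul_of_pos_left _ hT3)
    calc 2 * (T * a ^ 3) = T * a ^ 3 * 2 := by ring
      _ ≤ T * a ^ 3 * (T ^ 3 * a ^ 6) := Nat.mul_le_mul_left _ h6

end Literature.Probability.LatticeModels
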